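import Literature.AlgebraicGeometry.Morphisms.FlatBirationalOpenImmersion
import Literature.AlgebraicGeometry.Morphisms.IsoOverOpen
import Literature.AlgebraicGeometry.Resolution.StrictTransformPersistence
import Literature.AlgebraicGeometry.Resolution.StrictTransformAwayFromCentre
import Literature.AlgebraicGeometry.Resolution.StrictTransformBaseLocality
import Literature.AlgebraicGeometry.Resolution.SeparatingBlowup
import Literature.AlgebraicGeometry.Resolution.BlowupsExistence
import Literature.AlgebraicGeometry.Resolution.BlowupsProperProofs
import Literature.AlgebraicGeometry.Resolution.BlowupsCompositionFiniteType
import Literature.AlgebraicGeometry.Resolution.BlowupsProduct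
import HarnessLib

/-!
# A morphism which is an isomorphism over `U` becomes an open immersion after a
# `U`-admissible blowing up (Stacks 081S, from Raynaud–Gruson flattening 081R)

Topic: `Literature/AlgebraicGeometry/Resolution`. The Stacks Project, Tag 081S (More on Flatness,
Lemma 38.31.3): "Let `φ : X → S` be a separated morphism of finite type with `S` quasi-compact
and quasi-separated. Let `U ⊂ S` be a quasi-compact open such that `φ⁻¹U → U` is an isomorphism.
Then there exists a `U`-admissible blowup `S' → S` such that the strict transform `X'` of `X` is
isomorphic to an open subscheme of `S'`." This is the engine of three steps of the Stacks
Project's proof of Nagata's compactification theorem (Tag 0F41 via Lemmas 0F3W, 0F3X, 0F3Z;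
the named fact `Literature.AlgebraicGeometry.Morphisms.NagataCompactification`).

We PROVE it CONDITIONALLY on Raynaud–Gruson's flattening theorem in the form of the named fact
`Stacks081R` (`StrictTransformFlattening.lean`), following the printed proof: "The discussion in
Remark 30.1 applies. Thus we may do a first `U`-admissible blowup and assume the complement
`S ∖ U` is the support of an effective Cartier divisor `D`. In particular `U` is scheme
theoretically dense in `S`. Next, we do another `U`-admissible blowup to get to the situation
where `X → S` is flat and of finite presentation, see Lemma 31.1 [= 081R]. In this case the
result follows from Lemma 11.5 [= 081M]." In detail:

1. (Remark 30.1) `b₀ : S₀ → S`, the blowing up in an ideal sheaf `𝓘₀` of finite type with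
   `V(𝓘₀) = S ∖ U` (`exists_fg_support_eq_compl`, `exists_isBlowup`); `E₀ = b₀⁻¹𝓘₀ 𝒪_{S₀}` is an
   effective Cartier divisor with complement `U₀ = b₀⁻¹U`, and the strict transform
   `φ₀ : X₀ → S₀` is still an isomorphism over `U₀`
   (`isIso_blowupStrictTransformMap_morphismRestrict`).
2. (081R) a `U₀`-admissible blowing up `b₁ : S₁ → S₀` in `𝓘₁` flattening the strict transform of
   `φ₀`; we enlarge the centre to `𝓙 = 𝓘₁ · E₀` (same blowing up, `E₀` being invertible:
   `IsBlowup.mul_of_isEffectiveCartier`; `V(𝓙) = S₀ ∖ U₀` exactly), along which the strict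
   transform `φ₁ : X₁ → S₁` is still flat and locally of finite presentation (persistence,
   `blowupStrictTransformMap_of_dominating`), separated, an isomorphism over `b₁⁻¹U₀`, with
   `φ₁⁻¹(b₁⁻¹U₀)` retrocompact and schematically dense in `X₁` (by construction of the strict
   transform as a scheme-theoretic closure) — so `φ₁` is an open immersion by Tag 081M
   (`Morphisms.isOpenImmersion_of_flat_of_isIso_morphismRestrict`).
3. `b = b₁ ≫ b₀` is a `U`-admissible blowing up (`IsBlowup.exists_isBlowup_comp_admissible`,
   Stacks 080L) in a centre `𝓠` which we may take with `V(𝓠) = S ∖ U` (multiply by `𝓘₀`, which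
   becomes invertible upstairs: `IsBlowup.mul_of_isEffectiveCartier_comap`), and the strict
   transform of `φ` along `b` is `φ₁` (`blowupStrictTransformMap_comp_base_iff`: strict
   transforms along a composite of blowing ups are iterated strict transforms;
   `blowupStrictTransformMap_comp_iff_of_isClosedImmersion`: they only depend on the scheme
   over `U`).

* `isIso_blowupStrictTransformι_morphismRestrict`, `isIso_blowupStrictTransformMap_morphismRestrict`
  — over `b⁻¹(S ∖ V(𝓘))` the strict transform is the base change, so an isomorphism over `U`
  stays one over `b⁻¹U`;
* `blowupStrictTransformMap_comp_base_iff` — strict transform along `S₁ → S₀ → S` versus the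
  strict transform along `S₁ → S₀` of the base change to `S₀`;
* `stacks081S_of_stacks081R` — **Stacks 081S, conditional on `Stacks081R`**, with the centre
  normalised to `V(𝓠) = S ∖ U`.

Everything is proved; the only undischarged input is the hypothesis `(hRG : Stacks081R)`.

## References

* The Stacks Project, Tag 081S (Lemma 38.31.3) and its proof; Tags 081R, 081M, 080L, 080D,
  0F41. [StacksProject]
* M. Raynaud, L. Gruson, *Critères de platitude et de projectivité*, Invent. Math. 13 (1971),
  Première partie, Thm. 5.2.2 and 5.7. [RaynaudGruson1971]
-/

noncomputable section

-- Mathlib's pull-back API is stated through `abbrev`s over `limit`; as in Mathlib's own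
-- algebraic-geometry files we let `simp`/unification see through them.
set_option backward.isDefEq.respectTransparency false

open CategoryTheory CategoryTheory.Limits AlgebraicGeometry TopologicalSpace

namespace Literature.AlgebraicGeometry.Resolution

universe u

/-! ## Restricting scheme-theoretic images and strict transforms over opens -/

section Restrict

open Literature.AlgebraicGeometry.Morphisms

variable {X S S' : Scheme.{u}} (f : X ⟶ S) (b : S' ⟶ S) (I : S.IdealSheafData)

/-- **Over `b⁻¹(S ∖ V(𝓘))` the strict transform is all of `X ×_S S'`**: the closed immersion
`X' ↪ X ×_S S'` (Stacks 080D) is an isomorphism over the open lying over `b⁻¹(S ∖ V(𝓘))`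
(for `b⁻¹𝓘 𝒪_{S'}` an effective Cartier divisor, which makes that open retrocompact).
[cite: StacksProject, Tag 080D] -/
theorem isIso_blowupStrictTransformι_morphismRestrict (hE : IsEffectiveCartier (I.comap b)) :
    IsIso (blowupStrictTransformι f b I ∣_ (pullback.snd f b) ⁻¹ᵁ (b ⁻¹ᵁ centreCompl I)) := by
  haveI : QuasiCompact ((pullback.snd f b) ⁻¹ᵁ (b ⁻¹ᵁ centreCompl I)).ι := by
    rw [preimage_centreCompl]
    exact quasiCompact_ι_preimage_centreCompl _ hE
  exact isIso_imageι_morphismRestrict _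

/-- **An isomorphism over `S ∖ V(𝓘)` stays an isomorphism over `b⁻¹(S ∖ V(𝓘))` after strict
transform**: if `f|_{S ∖ V(𝓘)}` is an isomorphism then so is the restriction of the strict
transform `X' → S'` over `b⁻¹(S ∖ V(𝓘))` (it is `X' ≅ X ×_S S'` there, a base change of `f`).
[cite: StacksProject, Tag 080D] -/
theorem isIso_blowupStrictTransformMap_morphismRestrict (hE : IsEffectiveCartier (I.comap b))
    [IsIso (f ∣_ centreCompl I)] :
    IsIso (blowupStrictTransformMap f b I ∣_ b ⁻¹ᵁ centreCompl I) := by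
  haveI := isIso_blowupStrictTransformι_morphismRestrict f b I hE
  haveI : IsIso ((pullback.snd f b) ∣_ b ⁻¹ᵁ centreCompl I) :=
    isIso_morphismRestrict_pullback_snd f b (centreCompl I)
  exact isIso_morphismRestrict_comp (blowupStrictTransformι f b I) (pullback.snd f b) _

/-- **The dense open of the strict transform.** The open `φ'⁻¹(b⁻¹(S ∖ V(𝓘)))` of the strict
transform `φ' : X' → S'` is retrocompact and schematically dense in `X'`: `X'` is the
scheme-theoretic image of the open `O = (X ×_S S')|_{b⁻¹(S ∖ V(𝓘))}`, and `O → X'` is an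
isomorphism onto that open. [cite: StacksProject, Tag 080D] -/
theorem quasiCompact_and_isSchemeTheoreticallyDominant_ι_preimage
    (hE : IsEffectiveCartier (I.comap b)) :
    QuasiCompact ((blowupStrictTransformMap f b I) ⁻¹ᵁ (b ⁻¹ᵁ centreCompl I)).ι ∧
      IsSchemeTheoreticallyDominant ((blowupStrictTransformMap f b I) ⁻¹ᵁ (b ⁻¹ᵁ centreCompl I)).ι := by
  haveI hqc : QuasiCompact ((pullback.snd f b) ⁻¹ᵁ (b ⁻¹ᵁ centreCompl I)).ι := by
    rw [preimage_centreCompl]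
    exact quasiCompact_ι_preimage_centreCompl _ hE
  haveI hiso : IsIso (((pullback.snd f b) ⁻¹ᵁ (b ⁻¹ᵁ centreCompl I)).ι.imageι ∣_
      (pullback.snd f b) ⁻¹ᵁ (b ⁻¹ᵁ centreCompl I)) := isIso_imageι_morphismRestrict _
  haveI := Motives.isSchemeTheoreticallyDominant_toImage
    ((pullback.snd f b) ⁻¹ᵁ (b ⁻¹ᵁ centreCompl I)).ι
  -- the open in question is the preimage of `O = (X ×_S S')|_{b⁻¹(S ∖ E)}` under `X' ↪ X ×_S S'`,
  -- and `O → X'` is the inverse of `X'|_O ≅ O` followed by its inclusion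
  change QuasiCompact (((pullback.snd f b) ⁻¹ᵁ (b ⁻¹ᵁ centreCompl I)).ι.imageι ⁻¹ᵁ
      ((pullback.snd f b) ⁻¹ᵁ (b ⁻¹ᵁ centreCompl I))).ι ∧
    IsSchemeTheoreticallyDominant (((pullback.snd f b) ⁻¹ᵁ (b ⁻¹ᵁ centreCompl I)).ι.imageι ⁻¹ᵁ
      ((pullback.snd f b) ⁻¹ᵁ (b ⁻¹ᵁ centreCompl I))).ι
  have hfac : ((pullback.snd f b) ⁻¹ᵁ (b ⁻¹ᵁ centreCompl I)).ι.toImage =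
      inv (((pullback.snd f b) ⁻¹ᵁ (b ⁻¹ᵁ centreCompl I)).ι.imageι ∣_
        (pullback.snd f b) ⁻¹ᵁ (b ⁻¹ᵁ centreCompl I)) ≫
      (((pullback.snd f b) ⁻¹ᵁ (b ⁻¹ᵁ centreCompl I)).ι.imageι ⁻¹ᵁ
        ((pullback.snd f b) ⁻¹ᵁ (b ⁻¹ᵁ centreCompl I))).ι := by
    rw [← cancel_mono ((pullback.snd f b) ⁻¹ᵁ (b ⁻¹ᵁ centreCompl I)).ι.imageι,
      Scheme.Hom.toImage_imageι, Category.assoc, ← morphismRestrict_ι, IsIso.inv_hom_id_assoc]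
  have key : (((pullback.snd f b) ⁻¹ᵁ (b ⁻¹ᵁ centreCompl I)).ι.imageι ⁻¹ᵁ
      ((pullback.snd f b) ⁻¹ᵁ (b ⁻¹ᵁ centreCompl I))).ι =
      (((pullback.snd f b) ⁻¹ᵁ (b ⁻¹ᵁ centreCompl I)).ι.imageι ∣_
        (pullback.snd f b) ⁻¹ᵁ (b ⁻¹ᵁ centreCompl I)) ≫
      ((pullback.snd f b) ⁻¹ᵁ (b ⁻¹ᵁ centreCompl I)).ι.toImage := by
    rw [hfac, IsIso.hom_inv_id_assoc]
  rw [key]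
  exact ⟨inferInstance, inferInstance⟩

end Restrict

/-! ## Strict transforms along a composite of two morphisms of the base -/

section CompBase

variable {X S S₀ S₁ : Scheme.{u}} (f : X ⟶ S) (b₀ : S₀ ⟶ S) (b₁ : S₁ ⟶ S₀)
  (J : S₀.IdealSheafData) (Q : S.IdealSheafData)

/-- **Strict transform along a composite `S₁ → S₀ → S` versus the strict transform along
`S₁ → S₀` of the base change to `S₀`.** If the opens over which nothing changes coincide,
`b₁⁻¹(S₀ ∖ V(𝓙)) = (b₁ ≫ b₀)⁻¹(S ∖ V(𝓠))`, then a property of morphisms respecting isomorphisms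
holds for the strict transform of `f : X → S` along `b₁ ≫ b₀` (with respect to `V(𝓠)`) iff it
holds for the strict transform of `X ×_S S₀ → S₀` along `b₁` (with respect to `V(𝓙)`): both are
the scheme-theoretic closure of the same open of `(X ×_S S₀) ×_{S₀} S₁ ≅ X ×_S S₁`
(`subschemeι_ker_ι_comp_iff_of_iso`). [cite: StacksProject, Tag 080D] -/
theorem blowupStrictTransformMap_comp_base_iff (P : MorphismProperty Scheme.{u}) [P.RespectsIso]
    [QuasiCompact ((pullback.snd f (b₁ ≫ b₀)) ⁻¹ᵁ ((b₁ ≫ b₀) ⁻¹ᵁ centreCompl Q)).ι]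
    (hO : b₁ ⁻¹ᵁ centreCompl J = (b₁ ≫ b₀) ⁻¹ᵁ centreCompl Q) :
    P (blowupStrictTransformMap f (b₁ ≫ b₀) Q) ↔
      P (blowupStrictTransformMap (pullback.snd f b₀) b₁ J) :=
  subschemeι_ker_ι_comp_iff_of_iso (pullbackLeftPullbackSndIso f b₀ b₁).hom
    (pullback.snd f (b₁ ≫ b₀)) (pullback.snd (pullback.snd f b₀) b₁) _ _ P
    (pullbackLeftPullbackSndIso_hom_snd f b₀ b₁) (by
      rw [hO]
      simp only [← Scheme.Hom.comp_preimage, pullbackLeftPullbackSndIso_hom_snd_assoc])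

end CompBase

/-! ## Blowing ups: enlarging the centre by an ideal which becomes invertible upstairs -/

/-- If `π` is a blowing up of `X` along `K` and `L` is an ideal sheaf on `X` whose pull-back
`π⁻¹L 𝒪_{X'}` is an effective Cartier divisor, then `π` is also a blowing up of `X` along
`K · L` (same proof as `IsBlowup.mul_of_isEffectiveCartier`: `π⁻¹(K·L) = π⁻¹K · π⁻¹L` is
effective Cartier, and a morphism pulling `K·L` back to an effective Cartier divisor pulls `K`
back to one, Stacks 07ZV). [cite: StacksProject, Tag 080B (proof)] -/
theorem IsBlowup.mul_of_isEffectiveCartier_comap {X' X : Scheme.{u}} {π : X' ⟶ X}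
    {K L : X.IdealSheafData} (hπ : IsBlowup π K) (hL : IsEffectiveCartier (L.comap π)) :
    IsBlowup π (K * L) := by
  constructor
  · rw [comap_mul]
    exact hπ.isEffectiveCartier.mul hL
  · intro W g hg
    rw [comap_mul] at hg
    exact hπ.universal g hg.of_mul_left

/-! ## Stacks 081S from Stacks 081R -/

/-- **Stacks 081S, conditional on Raynaud–Gruson flattening (`Stacks081R`).** Let
`φ : X → S` be separated and of finite type, `S` quasi-compact and quasi-separated, and `U ⊆ S`
a quasi-compact open over which `φ` is an isomorphism. Then there is a `U`-admissible blowing up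
`b : S' → S` — in an ideal sheaf `𝓠` of finite type with `V(𝓠) = S ∖ U` — such that the strict
transform `X' → S'` of `φ` (Stacks 080D) is an open immersion. See the module docstring for the
proof. [cite: StacksProject, Tag 081S] -/
theorem stacks081S_of_stacks081R (hRG : Stacks081R.{u}) {X S : Scheme.{u}} (φ : X ⟶ S)
    [CompactSpace S] [QuasiSeparatedSpace S] [IsSeparated φ] [QuasiCompact φ]
    [LocallyOfFiniteType φ] (U : S.Opens) (hU : IsCompact (U : Set S)) [IsIso (φ ∣_ U)] :
    ∃ (Q : S.IdealSheafData) (S' : Scheme.{u}) (b : S' ⟶ S),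
      (∀ W : S.affineOpens, (Q.ideal W).FG) ∧ (Q.support : Set S) = (U : Set S)ᶜ ∧
      IsBlowup b Q ∧ IsOpenImmersion (blowupStrictTransformMap φ b Q) := by
  /- Step 1: a first blowing up making `S ∖ U` an effective Cartier divisor -/
  obtain ⟨I₀, hI₀fg, hI₀supp⟩ := exists_fg_support_eq_compl U hU
  have hccI₀ : centreCompl I₀ = U :=
    TopologicalSpace.Opens.ext (by change (I₀.support : Set S)ᶜ = U; rw [hI₀supp, compl_compl])
  subst hccI₀
  obtain ⟨S₀, b₀, hb₀⟩ := exists_isBlowup S I₀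
  have hE₀ : IsEffectiveCartier (I₀.comap b₀) := hb₀.isEffectiveCartier
  haveI : IsProper b₀ := IsBlowup.isProper_of_fg hI₀fg hb₀
  haveI : CompactSpace S₀ := QuasiCompact.compactSpace_of_compactSpace b₀
  haveI : QuasiSeparatedSpace S₀ := quasiSeparatedSpace_of_quasiSeparated b₀
  -- the strict transform `φ₀ : X₀ → S₀` of `φ` along `b₀`
  set φ₀ := blowupStrictTransformMap φ b₀ I₀ with hφ₀
  haveI : IsSeparated φ₀ :=
    inferInstanceAs (IsSeparated (blowupStrictTransformι φ b₀ I₀ ≫ pullback.snd φ b₀))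
  haveI : QuasiCompact φ₀ :=
    inferInstanceAs (QuasiCompact (blowupStrictTransformι φ b₀ I₀ ≫ pullback.snd φ b₀))
  haveI : LocallyOfFiniteType φ₀ :=
    inferInstanceAs (LocallyOfFiniteType (blowupStrictTransformι φ b₀ I₀ ≫ pullback.snd φ b₀))
  -- `U₀ = b₀⁻¹ U` is the complement of the exceptional divisor; `φ₀` is an isomorphism over it
  set U₀ : S₀.Opens := b₀ ⁻¹ᵁ centreCompl I₀ with hU₀
  have hU₀c : IsCompact (U₀ : Set S₀) := b₀.isCompact_preimage hU
  haveI hiso₀ : IsIso (φ₀ ∣_ U₀) := isIso_blowupStrictTransformMap_morphismRestrict φ b₀ I₀ hE₀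
  /- Step 2: flatten `φ₀` by a `U₀`-admissible blowing up (Raynaud–Gruson, Stacks 081R) -/
  obtain ⟨I₁, S₁, b₁, hI₁fg, hI₁U, hb₁, hflat, hlfp⟩ := hRG φ₀ U₀ hU₀c inferInstance inferInstance
  -- enlarge the centre by the exceptional divisor: `J = I₁ · E₀`, with `V(J) = S₀ ∖ U₀` exactly
  set J : S₀.IdealSheafData := I₁ * I₀.comap b₀ with hJ
  have hbJ : IsBlowup b₁ J := hb₁.mul_of_isEffectiveCartier hE₀
  have hEJ : IsEffectiveCartier (J.comap b₁) := hbJ.isEffectiveCartier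
  have hJfg : ∀ W : S₀.affineOpens, (J.ideal W).FG := fun W => by
    rw [hJ, Scheme.IdealSheafData.ideal_mul, Pi.mul_apply]
    exact (hI₁fg W).mul (hE₀.fg_ideal W)
  have hJsupp : (J.support : Set S₀) = (U₀ : Set S₀)ᶜ := by
    have h1 : ((I₀.comap b₀).support : Set S₀) = (U₀ : Set S₀)ᶜ := by
      rw [Scheme.IdealSheafData.support_comap, hU₀]
      ext x
      change b₀ x ∈ (I₀.support : Set S) ↔ ¬ (b₀ x ∈ (I₀.support : Set S)ᶜ)
      rw [Set.mem_compl_iff, not_not]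
    rw [hJ, Scheme.IdealSheafData.support_mul, TopologicalSpace.Closeds.coe_sup, h1]
    exact Set.union_eq_right.mpr (hI₁U.subset_compl_left)
  have hccJ : centreCompl J = U₀ :=
    TopologicalSpace.Opens.ext (by change (J.support : Set S₀)ᶜ = U₀; rw [hJsupp, compl_compl])
  -- the strict transform `φ₁ : X₁ → S₁` of `φ₀` along `b₁` with respect to `V(J)` is flat …
  set φ₁ := blowupStrictTransformMap φ₀ b₁ J with hφ₁
  haveI : Flat (blowupStrictTransformMap φ₀ b₁ I₁) := hflat
  haveI : LocallyOfFinitePresentation (blowupStrictTransformMap φ₀ b₁ I₁) := hlfp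
  have hsupple : (I₁.support : Set S₀) ⊆ J.support := by
    rw [hJ, Scheme.IdealSheafData.support_mul, TopologicalSpace.Closeds.coe_sup]
    exact Set.subset_union_left
  haveI : Flat φ₁ :=
    flat_blowupStrictTransformMap_of_dominating I₁ J (Category.id_comp b₁) hsupple hEJ
  haveI : LocallyOfFinitePresentation φ₁ :=
    locallyOfFinitePresentation_blowupStrictTransformMap_of_dominating I₁ J (Category.id_comp b₁)
      hsupple hEJ
  haveI : IsSeparated φ₁ :=
    inferInstanceAs (IsSeparated (blowupStrictTransformι φ₀ b₁ J ≫ pullback.snd φ₀ b₁))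
  -- … an isomorphism over `b₁⁻¹ U₀`, with retrocompact schematically dense preimage: an open
  -- immersion (Stacks 081M)
  haveI : IsIso (φ₀ ∣_ centreCompl J) := by rw [hccJ]; exact hiso₀
  haveI : IsIso (φ₁ ∣_ b₁ ⁻¹ᵁ centreCompl J) :=
    isIso_blowupStrictTransformMap_morphismRestrict φ₀ b₁ J hEJ
  obtain ⟨hqc, hsd⟩ := quasiCompact_and_isSchemeTheoreticallyDominant_ι_preimage φ₀ b₁ J hEJ
  haveI := hqc
  haveI := hsd
  have hopen : IsOpenImmersion φ₁ :=
    Morphisms.isOpenImmersion_of_flat_of_isIso_morphismRestrict φ₁ (b₁ ⁻¹ᵁ centreCompl J)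
  /- Step 3: the composite blowing up and the identification of strict transforms -/
  have hU₀disj : Disjoint ((b₀ ⁻¹ᵁ centreCompl I₀ : S₀.Opens) : Set S₀) (J.support : Set S₀) := by
    rw [hJsupp]
    exact disjoint_compl_right
  have hUdisj : Disjoint ((centreCompl I₀ : S.Opens) : Set S) (I₀.support : Set S) :=
    disjoint_compl_left
  obtain ⟨Q, hQfg, hQU, hbQ⟩ :=
    hb₀.exists_isBlowup_comp_admissible (centreCompl I₀) hI₀fg hUdisj hbJ hJfg hU₀disj
  -- normalise the centre: `Q · I₀` has support exactly `S ∖ U` and the same blowing up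
  have hI₀b : IsEffectiveCartier (I₀.comap (b₁ ≫ b₀)) := by
    have h : IsEffectiveCartier ((I₁ * I₀.comap b₀).comap b₁) := hEJ
    rw [comap_mul] at h
    rw [Scheme.IdealSheafData.comap_comp]
    exact h.of_mul_right
  have hbQ' : IsBlowup (b₁ ≫ b₀) (Q * I₀) := hbQ.mul_of_isEffectiveCartier_comap hI₀b
  have hQsupp : ((Q * I₀).support : Set S) = ((centreCompl I₀ : S.Opens) : Set S)ᶜ := by
    rw [Scheme.IdealSheafData.support_mul, TopologicalSpace.Closeds.coe_sup, hI₀supp]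
    exact Set.union_eq_right.mpr hQU.subset_compl_left
  have hccQ : centreCompl (Q * I₀) = centreCompl I₀ :=
    TopologicalSpace.Opens.ext (by
      change ((Q * I₀).support : Set S)ᶜ = (centreCompl I₀ : S.Opens)
      rw [hQsupp, compl_compl])
  refine ⟨Q * I₀, S₁, b₁ ≫ b₀, fun W => ?_, hQsupp, hbQ', ?_⟩
  · rw [Scheme.IdealSheafData.ideal_mul, Pi.mul_apply]
    exact (hQfg W).mul (hI₀fg W)
  -- transport `hopen` along the identifications of strict transforms
  haveI : QuasiCompact ((pullback.snd φ (b₁ ≫ b₀)) ⁻¹ᵁ ((b₁ ≫ b₀) ⁻¹ᵁ centreCompl (Q * I₀))).ι := by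
    rw [preimage_centreCompl]
    exact quasiCompact_ι_preimage_centreCompl _ hbQ'.isEffectiveCartier
  rw [blowupStrictTransformMap_comp_base_iff φ b₀ b₁ J (Q * I₀) @IsOpenImmersion
    (by rw [hccQ, hccJ, Scheme.Hom.comp_preimage])]
  haveI : IsIso (blowupStrictTransformι φ b₀ I₀ ∣_ (pullback.snd φ b₀) ⁻¹ᵁ centreCompl J) := by
    rw [hccJ]
    exact isIso_blowupStrictTransformι_morphismRestrict φ b₀ I₀ hE₀
  exact (blowupStrictTransformMap_comp_iff_of_isClosedImmersion (blowupStrictTransformι φ b₀ I₀)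
    (pullback.snd φ b₀) b₁ J @IsOpenImmersion hEJ).mp hopen

end Literature.AlgebraicGeometry.Resolution

end
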